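import Summits.BirchSwinnertonDyer.BirchSwinnertonDyer.Theorems.KolyvaginRankRigidityAtTwoWalkBridge
import Literature.NumberTheory.EllipticCurves.HeegnerPointsOfConductor
import Literature.NumberTheory.EllipticCurves.HeegnerPointsKolyvaginEulerSystem
import Literature.NumberTheory.EllipticCurves.Jetchev2008.CoreVertices
import Literature.NumberTheory.EllipticCurves.ModularCurve
import Literature.NumberTheory.EllipticCurves.Isogeny
import Literature.NumberTheory.EllipticCurves.Rank1Residual.Predicates
import HarnessLib

/-!
# Crux U1 `KolyvaginBoundedDefectAtTwo` (stmt-BirchSwinnertonDyer-28083), LINE 17 `kolyvagin_swap` — DEFINITIONS: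
# the statement layer of the pen's v8.x skeleton (HOME `line17/kolyvagin_swap_v85_UNCHECKED.lean` sha16 1a50902741cceb1e), VERBATIM,
# so that the line's kernel compositions can be landed under `Theorems/` BY NAME instead of living only in a `sorry`-carrying skeleton

Width seat `bsd-line-krr2-p2` g19 (ONE READER on LINE 17; route `KolyvaginRankRigidityAtTwo`).  DEFINITIONS ONLY (`def … : Prop` bodies
copied byte-for-byte from the pen `bsd-idea-1`'s v8.5 skeleton §3–§4, docstrings the pen's; plus the walk's bookkeeping function `room`).
Nothing is asserted or proved here; in particular the INPUT `KolyvaginRoomSeedAtTwo` (S0ʳ, Kolyvagin's conjecture at 2 in room form) is a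
HYPOTHESIS of the line, not a fact, and is never taken as a Literature fact.  The theorems that consume these definitions
(`…KolyvaginSwapVertical`, `…KolyvaginSwapAssembly`: U1 ⟸ S0ʳ + Gross 1991 Prop. 3.7 (2)) live in separate proof files.
No summit / crux / rung is proved by filing definitions.  **BSD is NOT proved.**

Contents (pen's names, namespace `…Theorems.KolyvaginAtTwo.KolyvaginSwap`): `KolyvaginRoomSeedAtTwo` (S0ʳ, INPUT) · `OppShape` (the shape
`Sh(t, a)` of the `(−u)`-part of an engine Selmer group) · `LevelDropAtTwo` (LD; tree theorem `RegularWalk.levelDropAtTwo`) ·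
`KolyvaginClassSignAtTwo` (sign law, tree) · `StartShapeAtTwo` (START; tree theorem `RegularWalk.startShapeAtTwo`) · `ShedSeedPrimeShapedAtTwo`
(SWα⁗; tree theorem mod P372 `RegularWalk.shedSeedPrimeShapedAtTwo_of_frobeniusCongruence`) · `LoneSeedPartnerAtTwo` (Zζ; tree theorem mod P372
`RegularWalk.loneSeedPartnerAtTwo_of_frobeniusCongruence`) · `SeedPrimeSwapShapedAtTwo` (SW⁗) · `SingularToVisibleAtTwo` (EV; tree theorem
`KolyvaginSwap.singularToVisibleAtTwo_holds`, LEAD p734235) · `room` · `VerticalGrowthAtTwo` (VG) · `DeepSeedAtTwo` (S0⁺).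
References (locators only): [cite: Kolyvagin1991MathAnn, §2] [cite: Kolyvagin1991StructureSha, Prop. 8] [cite: MazurRubin2004, §4.1]
[cite: GrossLMS1991, §3, §9] [cite: McCallumLMS1991, §4–§5] [cite: WZhang2014, Thm. 1.1].
-/

set_option autoImplicit false
-- the Theorems namespace of this sub repeats the summit name by design (D-0017 nested layout)
set_option linter.dupNamespace false

noncomputable section

open scoped Classical
open WeierstrassCurve NumberField IsDedekindDomain Field
open Literature.NumberTheory.GaloisRepresentations Literature.NumberTheory.EllipticCurves Literature.NumberTheory
open Literature.NumberTheory.EllipticCurves.ModularForms Literature.NumberTheory.EllipticCurves.KolyvaginCocycle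
open Rat.HeightOneSpectrum
open Summit.BirchSwinnertonDyer.BirchSwinnertonDyer.Theorems

namespace Summit.BirchSwinnertonDyer.BirchSwinnertonDyer.Theorems.KolyvaginAtTwo.KolyvaginSwap

/-- S0ʳ · ROOM SEED AT 2 (THE INPUT of the line; Kolyvagin's conjecture at 2 in Kolyvagin's `k(r)`-form).  On U1's habitat and frame:
there is a depth `r` such that for every room `k` some square-free Kolyvagin conductor `n` with exactly `r` prime factors, some level
`1 ≤ M ≤ M(n)` and some Kolyvagin–Heegner datum `d` have `c_M(n)` of VISIBLE order `> 2^k`: `2^k · [c_M(n), ρ] ≠ 0` for some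
`ρ ∈ Γ_{K(E[2^M])}` (`torsionFixing`, `h1Eval` — the tree's Gross §9 pairing).  Between the S0 cell's frame `KolyvaginNonvanishingAtTwoFrame`
(implied: a visible class is non-zero) and U1 (which implies it, given the one-bit phantom line K1⁺); it does NOT by itself put a non-zero
class of a FIXED level on conductors of unbounded index (that is what SW adds).  In print for `ℓ` odd with surjective `ρ̄` this much is what
Zhang 2014 / Kolyvagin's `m_r < ∞` give; at 2 it is beyond print like every form of Kolyvagin's conjecture.  Why it might fail: only with
Kolyvagin's conjecture at 2 itself, or if all depth-`r` classes at 2 were phantoms / of bounded order (no known mechanism).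
[cite: Kolyvagin1991MathAnn, §2 (2.1), Conj. 2.5 and the k(r) remark] [cite: WZhang2014, Thm. 1.1] [cite: GrossLMS1991, §9] -/
@[conjecture] def KolyvaginRoomSeedAtTwo : Prop :=
  ∀ (W : WeierstrassCurve ℚ) [W.IsElliptic] [W.IsGloballyMinimal], ¬ W.HasCM → (Literature.NumberTheory.EllipticCurves.Rank1Residual.GoodOrd W 2 ∨ Literature.NumberTheory.EllipticCurves.Rank1Residual.Mult W 2) → (∀ m : ℕ, W.HasSurjectiveModNGaloisRep (2 ^ m : ℕ)) → ∀ (K : Type) [Field K] [NumberField K], Literature.NumberTheory.EllipticCurves.IsImaginaryQuadratic K → ∀ [NeZero (W.conductorNorm ℤ)], Literature.NumberTheory.EllipticCurves.SatisfiesHeegnerHypothesis (W.conductorNorm ℤ) K → Odd (NumberField.discr K) → NumberField.discr K ≠ -3 → AddSubgroup.torsionBy (W.baseChange K).toAffine.Point (2 : ℤ) = ⊥ → Literature.NumberTheory.EllipticCurves.SatisfiesHeegnerHypothesis 2 K → ∀ (Dt : Literature.NumberTheory.EllipticCurves.ModularForms.ModularParametrizationData W (W.conductorNorm ℤ)) (β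 : ℤ) (ι : K →+* ℂ), (4 * (W.conductorNorm ℤ : ℤ)) ∣ β ^ 2 - NumberField.discr K →
    ∃ r : ℕ, ∀ k : ℕ, ∃ (n : ℕ) (d : Literature.NumberTheory.EllipticCurves.KolyvaginHeegnerData Dt β ι n) (M : ℕ),
      Literature.NumberTheory.EllipticCurves.KolyvaginDescent.KolSupp (Literature.NumberTheory.EllipticCurves.Zhang2014.IsKolyvaginPrime (W.conductorNorm ℤ) W K 2) n ∧
      n.primeFactors.card = r ∧ 1 ≤ M ∧ ((M : ℕ) : ℕ∞) ≤ Literature.NumberTheory.EllipticCurves.Zhang2014.levelIndex W 2 n ∧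
      ∃ ρ ∈ torsionFixing (W.baseChange K) ((2 ^ M : ℕ) : ℤ),
        ((2 ^ k : ℕ) : ℤ) • h1Eval (W.baseChange K) ((2 ^ M : ℕ) : ℤ) (d.kolyvaginClass Nat.prime_two M) ρ ≠ 0

/-- **THE SHAPE `Sh(t, a)` OF THE `(−u)`-PART OF THE ENGINE SELMER GROUP** (v7.4; the invariant the signed refill law preserves).  In the engine
adapter's currency (`WalkEngineAdapter.exists_regular_kolyvaginPrime_killing`: relations read modulo classes vanishing on `Γ_{K(E[2^{M+1}])}` — the
phantom line K1⁺, one bit): there are exact `(−u)`-eigenclasses `g₁,…,g_t ∈ H := H_{𝓕(e)}(K,E[2^M])` (`Jetchev2008.modifiedSelmerGroup … e`) that are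
NEARLY FREE (`Σ bᵢ gᵢ ≡ 0 ⟹ 2^{M−a} ∣ bᵢ`) and such that every exact `(−u)`-eigenclass `y ∈ H` has `2^a y ≡ Σ bᵢ gᵢ` (NO MEDIUM CLASSES outside the
span).  At `e = 1` this is the tree's start frame read per sign (`RegularWalk.startFrameAtTwo_holds`: `J`, `d` uniform in the level). -/
def OppShape (W : WeierstrassCurve ℚ) [W.IsElliptic] (K : Type) [Field K] [NumberField K] (ι : K →+* ℂ)
    [∀ k : ℕ, NumberField (ringClassField K ι k)] (τ : K ≃ₐ[ℚ] K) (M e : ℕ) (u : ℤ) (a t : ℕ) : Prop :=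
  ∃ (g : Fin t → galH1Torsion (W.baseChange K) ((2 ^ M : ℕ) : ℤ)),
    (∀ i, g i ∈ Jetchev2008.modifiedSelmerGroup W K ι ((2 ^ M : ℕ) : ℤ) e) ∧
    (∀ i, conjAct W τ ((2 ^ M : ℕ) : ℤ) (g i) = (-u) • g i) ∧
    (∀ b : Fin t → ℤ, (∀ σ ∈ torsionFixing (W.baseChange K) ((2 ^ (M + 1) : ℕ) : ℤ),
        h1Eval (W.baseChange K) ((2 ^ M : ℕ) : ℤ) (∑ i, b i • g i) σ = 0) → ∀ i, (2 : ℤ) ^ (M - a) ∣ b i) ∧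
    (∀ y : galH1Torsion (W.baseChange K) ((2 ^ M : ℕ) : ℤ), y ∈ Jetchev2008.modifiedSelmerGroup W K ι ((2 ^ M : ℕ) : ℤ) e →
      conjAct W τ ((2 ^ M : ℕ) : ℤ) y = (-u) • y →
      ∃ b : Fin t → ℤ, ∀ σ ∈ torsionFixing (W.baseChange K) ((2 ^ (M + 1) : ℕ) : ℤ),
        h1Eval (W.baseChange K) ((2 ^ M : ℕ) : ℤ) (((2 : ℤ) ^ a) • y - ∑ i, b i • g i) σ = 0)

/-- LD · LEVEL DROP (routine support, S): visible order survives one level down at the cost of one bit, and a class of visible order `> 2`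
has level `≥ 2`: `c_{M−1}(n) = (·2)_* c_M(n)` (`E(K_n)/2^M → E(K_n)/2^{M−1}` on the Kummer side), `[c_{M−1}(n), ρ] = 2·[c_M(n), ρ]` for
`ρ ∈ Γ_{K(E[2^M])} ≤ Γ_{K(E[2^{M−1}])}` (K1⁺ level-change API `RegularValueEngine.h1Eval_torsionH1OfDvd`), and `2^M` kills `[c_M(n), ρ] ∈ E[2^M]`.
This is how the kernel gets MARGIN ONE for free: the whole walk runs at level `M−1` where the seed had level `M ≤ M(n)`. -/
def LevelDropAtTwo : Prop :=
  ∀ (W : WeierstrassCurve ℚ) [W.IsElliptic] [W.IsGloballyMinimal], ¬ W.HasCM → (Literature.NumberTheory.EllipticCurves.Rank1Residual.GoodOrd W 2 ∨ Literature.NumberTheory.EllipticCurves.Rank1Residual.Mult W 2) → (∀ m : ℕ, W.HasSurjectiveModNGaloisRep (2 ^ m : ℕ)) → ∀ (K : Type) [Field K] [NumberField K], Literature.NumberTheory.EllipticCurves.IsImaginaryQuadratic K → ∀ [NeZero (W.conductorNorm ℤ)], Literature.NumberTheory.EllipticCurves.SatisfiesHeegnerHypothesis (W.conductorNorm ℤ)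 K → Odd (NumberField.discr K) → NumberField.discr K ≠ -3 → AddSubgroup.torsionBy (W.baseChange K).toAffine.Point (2 : ℤ) = ⊥ → Literature.NumberTheory.EllipticCurves.SatisfiesHeegnerHypothesis 2 K → ∀ (Dt : Literature.NumberTheory.EllipticCurves.ModularForms.ModularParametrizationData W (W.conductorNorm ℤ)) (β : ℤ) (ι : K →+* ℂ) [∀ k : ℕ, NumberField (ringClassField K ι k)], (4 * (W.conductorNorm ℤ : ℤ)) ∣ β ^ 2 - NumberField.discr K →
    ∀ (n M k : ℕ) (d : Literature.NumberTheory.EllipticCurves.KolyvaginHeegnerData Dt β ι n), 1 ≤ M →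
      (∃ ρ ∈ torsionFixing (W.baseChange K) ((2 ^ M : ℕ) : ℤ),
          ((2 ^ (k + 1) : ℕ) : ℤ) • h1Eval (W.baseChange K) ((2 ^ M : ℕ) : ℤ) (d.kolyvaginClass Nat.prime_two M) ρ ≠ 0) →
      2 ≤ M ∧ ∃ ρ ∈ torsionFixing (W.baseChange K) ((2 ^ (M - 1) : ℕ) : ℤ),
          ((2 ^ k : ℕ) : ℤ) • h1Eval (W.baseChange K) ((2 ^ (M - 1) : ℕ) : ℤ) (d.kolyvaginClass Nat.prime_two (M - 1)) ρ ≠ 0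

/-- SIGN LAW AT 2 (START⁗ part (i), v7.6: NO LONGER A STUB — proved below from the tree theorem
`GenusExact.KolyvaginClassSign.sign_conjAct_kolyvaginClass_two`, Gross 1991 Prop. 5.4 at `p = 2`, located by the LEAD cruxlead-28083 g0):
every Kolyvagin class `c_M(n)` on a square-free Kolyvagin conductor of level `≥ M ≥ 1` is an EXACT `τ`-eigenclass of sign `u = −w(E)·(−1)^{#n}`.
(ref: GrossLMS1991, §5 Prop. 5.3, Prop. 5.4) (ref: McCallumLMS1991, §5) -/
def KolyvaginClassSignAtTwo : Prop :=
  ∀ (W : WeierstrassCurve ℚ) [W.IsElliptic] [W.IsGloballyMinimal], ¬ W.HasCM → (Literature.NumberTheory.EllipticCurves.Rank1Residual.GoodOrd W 2 ∨ Literature.NumberTheory.EllipticCurves.Rank1Residual.Mult W 2) → (∀ m : ℕ, W.HasSurjectiveModNGaloisRep (2 ^ m : ℕ)) → ∀ (K : Type) [Field K] [NumberField K], Literature.NumberTheory.EllipticCurves.IsImaginaryQuadratic K → ∀ [NeZero (W.conductorNorm ℤ)], Literature.NumberTheory.EllipticCurves.SatisfiesHeegnerHypothesis (W.conductorNorm ℤ)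 K → Odd (NumberField.discr K) → NumberField.discr K ≠ -3 → AddSubgroup.torsionBy (W.baseChange K).toAffine.Point (2 : ℤ) = ⊥ → Literature.NumberTheory.EllipticCurves.SatisfiesHeegnerHypothesis 2 K → ∀ (Dt : Literature.NumberTheory.EllipticCurves.ModularForms.ModularParametrizationData W (W.conductorNorm ℤ)) (β : ℤ) (ι : K →+* ℂ) [∀ k : ℕ, NumberField (ringClassField K ι k)], (4 * (W.conductorNorm ℤ : ℤ)) ∣ β ^ 2 - NumberField.discr K →
    ∀ (τ : K ≃ₐ[ℚ] K), τ ≠ 1 →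
      ∀ (n M : ℕ) (d : Literature.NumberTheory.EllipticCurves.KolyvaginHeegnerData Dt β ι n),
        Literature.NumberTheory.EllipticCurves.KolyvaginDescent.KolSupp (Literature.NumberTheory.EllipticCurves.Zhang2014.IsKolyvaginPrime (W.conductorNorm ℤ) W K 2) (n) → 1 ≤ M → ((M : ℕ) : ℕ∞) ≤ Literature.NumberTheory.EllipticCurves.Zhang2014.levelIndex W 2 n →
        ∃ u : ℤ, (u = 1 ∨ u = -1) ∧ conjAct W τ ((2 ^ M : ℕ) : ℤ) (d.kolyvaginClass Nat.prime_two M) = u • d.kolyvaginClass Nat.prime_two M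

/-- START⁗ · THE START SHAPE (support, S; v7.6 = part (ii) only — part (i), the sign law, is the kernel theorem above): at `e = 1` the shape
`Sh(t, a₀)` holds for BOTH signs with ONE error `a₀` uniform in `M` and some rank `t` — the tree's `RegularWalk.startFrameAtTwo_holds`
(eigen-frame of `Sel_{2^k}(E/K)`, span up to `2^J`, near-independence `2^{k−d}`) restricted to the `(−u)`-signed sub-frame (`(1−uτ)`-symmetrisation,
`a₀ = max(J,d) + 1`).  Any `2^∞`-Selmer rank: U1 is rank-agnostic and so is this. (ref: Greenberg1999, §1–2) (ref: GrossLMS1991, §5) -/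
def StartShapeAtTwo : Prop :=
  ∀ (W : WeierstrassCurve ℚ) [W.IsElliptic] [W.IsGloballyMinimal], ¬ W.HasCM → (Literature.NumberTheory.EllipticCurves.Rank1Residual.GoodOrd W 2 ∨ Literature.NumberTheory.EllipticCurves.Rank1Residual.Mult W 2) → (∀ m : ℕ, W.HasSurjectiveModNGaloisRep (2 ^ m : ℕ)) → ∀ (K : Type) [Field K] [NumberField K], Literature.NumberTheory.EllipticCurves.IsImaginaryQuadratic K → ∀ [NeZero (W.conductorNorm ℤ)], Literature.NumberTheory.EllipticCurves.SatisfiesHeegnerHypothesis (W.conductorNorm ℤ) K → Odd (NumberField.discr K) → NumberField.discr K ≠ -3 → AddSubgroup.torsionBy (W.baseChange K).toAffine.Point (2 : ℤ) = ⊥ → Literature.NumberTheory.EllipticCurves.SatisfiesHeegnerHypothesis 2 K → ∀ (Dt : Literature.NumberTheory.EllipticCurves.ModularForms.ModularParametrizationData W (W.conductorNorm ℤ)) (β : ℤ) (ι : K →+* ℂ) [∀ k : ℕ, NumberField (ringClassField K ι k)], (4 * (W.conductorNorm ℤ : ℤ)) ∣ β ^ 2 - NumberField.discr K →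
    ∀ (τ : K ≃ₐ[ℚ] K), τ ≠ 1 →
      ∃ a₀ : ℕ, ∀ (M : ℕ) (u : ℤ), 1 ≤ M → (u = 1 ∨ u = -1) → ∃ t : ℕ, OppShape W K ι τ M 1 u a₀ t

/-- SWα⁗ · SHED A SEED PRIME BY RECIPROCITY, SHAPED (THE hand of v7.4, size L if the signed refill law survives; replaces v7.3's SWα and
carries (a⁗) as a THREADED INVARIANT instead of an existence problem).  Hypotheses of SW⁗; conclusion: the conductor bookkeeping, the new
shape `Sh(·, g a)` at `e·f`, the exact sign of the new class, and a datum `dup` at `(s'·e·f)·q` compatible with `d'` in GK2's Q2 sense whose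
class `2^v · c_M((s'ef)q)` is NOT Selmer-local at the prime `w ∣ q` (singular order `> 2^v`).  BLUEPRINT (card §v7.4): PARTNER `z` of exact
sign `−u`, nearly full — rank `t ≥ 1`: `z := g₁`; `t = 0`: the signed refill law for `𝓕(e) → 𝓕(qe)` at any seed prime `q`
(`#A_q^{−u} ≤ 2^{a+1}` ⟹ `B_q^{−u}` nearly full) gives `z ∈ H_{𝓕(qe)}`; ENGINE `ℓ` by `WalkEngineAdapter.exists_regular_kolyvaginPrime_killing`
(`p := c`, `q := z`, kept `g₂…g_t`, index `≥ I`); `B := ⟨loc_ℓ z, φ_ℓ loc_ℓ c⟩` of exponent `≥ e(c) − 2a − O(1)` (same-sign lines pair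
perfectly: `RegularRefillSign`, `invWeilPairing_symm`, `localTatePairingZMod_conjActPlace`); RECIPROCITY for `(z, c_M(seℓ))` — engine places and
(`t = 0`) the place `q` vanish (`tr ⊥ tr`, exact transversality at margin one: `kolyvaginClass_mem_transverseKer_two`), `v ∣ 2N` killed by `2^b`,
so some seed prime `q*` carries singular order `> 2^v` once `κ a ≥ 2a + b + O(1)` (`t = 0` ⟹ `q* ≠ q`, available since then `#s ≥ 2`:
the corner `#s = 1 ∧ t = 0` is EXCLUDED by hypothesis here and VACUOUS by Zζ `LoneSeedPartnerAtTwo`, v7.5).  PERSISTENCE by the signed refill law at `ℓ`: `t ≥ 1` ⟹ tiny `(−u)`-refill, `Sh(t−1, 2a+O(1))`; `t = 0` ⟹ nearly-full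
`(−u)`-refill FORCED, `Sh(1, 2a+O(1))`.  Why it might fail: (α) the `O(1)` bits of the per-eigen-plane refill law must not grow with `M`
(split-type `E[2^M]^± ≅ ℤ/2^M ⊕ ℤ/2`); (β) (b″) uniform `2^b` at `v ∣ 2N`; (γ) (c″) exact signs at 2; (δ) Q2 needs P372.
(ref: Kolyvagin1991StructureSha, Prop. 8) (ref: MazurRubin2004, §4.1 Prop. 4.1.5, Lemma 4.1.7, Thm. 2.3.4) (ref: GrossLMS1991, §5, §9)
(ref: McCallumLMS1991, §5) -/
def ShedSeedPrimeShapedAtTwo : Prop :=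
  ∀ (W : WeierstrassCurve ℚ) [W.IsElliptic] [W.IsGloballyMinimal], ¬ W.HasCM → (Literature.NumberTheory.EllipticCurves.Rank1Residual.GoodOrd W 2 ∨ Literature.NumberTheory.EllipticCurves.Rank1Residual.Mult W 2) → (∀ m : ℕ, W.HasSurjectiveModNGaloisRep (2 ^ m : ℕ)) → ∀ (K : Type) [Field K] [NumberField K], Literature.NumberTheory.EllipticCurves.IsImaginaryQuadratic K → ∀ [NeZero (W.conductorNorm ℤ)], Literature.NumberTheory.EllipticCurves.SatisfiesHeegnerHypothesis (W.conductorNorm ℤ) K → Odd (NumberField.discr K) → NumberField.discr K ≠ -3 → AddSubgroup.torsionBy (W.baseChange K).toAffine.Point (2 : ℤ) = ⊥ → Literature.NumberTheory.EllipticCurves.SatisfiesHeegnerHypothesis 2 K → ∀ (Dt : Literature.NumberTheory.EllipticCurves.ModularForms.ModularParametrizationData W (W.conductorNorm ℤ)) (β : ℤ) (ι : K →+* ℂ) [∀ k : ℕ, NumberField (ringClassField K ι k)], (4 * (W.conductorNorm ℤ : ℤ)) ∣ β ^ 2 - NumberField.discr K →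
    ∀ (τ : K ≃ₐ[ℚ] K), τ ≠ 1 → ∀ (u : ℤ), (u = 1 ∨ u = -1) →
    ∃ κ g : ℕ → ℕ, ∀ (a t I M v s e : ℕ) (d : Literature.NumberTheory.EllipticCurves.KolyvaginHeegnerData Dt β ι (s * e)),
      Literature.NumberTheory.EllipticCurves.KolyvaginDescent.KolSupp (Literature.NumberTheory.EllipticCurves.Zhang2014.IsKolyvaginPrime (W.conductorNorm ℤ) W K 2) (s * e) →
      s ≠ 1 → 1 ≤ M → M + 1 ≤ I → (((M + 1 : ℕ) : ℕ) : ℕ∞) ≤ Literature.NumberTheory.EllipticCurves.Zhang2014.levelIndex W 2 (s * e) →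
      (∀ p ∈ (e).primeFactors, I ≤ Literature.NumberTheory.EllipticCurves.Zhang2014.kolyvaginIndex W 2 p ∧ (∃ (pl : HeightOneSpectrum (𝓞 ℚ)) (𝔓 : Ideal (absIntegers (𝓞 ℚ) ℚ)) (h : absoluteGaloisGroup ℚ), (p : 𝓞 ℚ) ∈ pl.asIdeal ∧ 𝔓 ∈ pl.primesAbove ∧ IsArithFrobAt (𝓞 ℚ) h 𝔓 ∧ (∀ X : geomTorsion W ((2 ^ M : ℕ) : ℤ), h • h • X = X) ∧ ∃ P : geomTorsion W ((2 ^ M : ℕ) : ℤ), (2 : ℤ) ^ (M - 1) • (P + h • P) ≠ 0)) →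
      OppShape W K ι τ M e u a t →
      (1 ≤ t ∨ 2 ≤ s.primeFactors.card) →
      conjAct W τ ((2 ^ M : ℕ) : ℤ) (d.kolyvaginClass Nat.prime_two M) = u • d.kolyvaginClass Nat.prime_two M →
      (∃ ρ ∈ torsionFixing (W.baseChange K) ((2 ^ M : ℕ) : ℤ),
          ((2 ^ (v + κ a) : ℕ) : ℤ) • h1Eval (W.baseChange K) ((2 ^ M : ℕ) : ℤ) (d.kolyvaginClass Nat.prime_two M) ρ ≠ 0) →
      ∃ (q s' f t' : ℕ) (d' : Literature.NumberTheory.EllipticCurves.KolyvaginHeegnerData Dt β ι (s' * (e * f))),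
        s = q * s' ∧ q.Prime ∧
        (∀ p ∈ (e * f).primeFactors, I ≤ Literature.NumberTheory.EllipticCurves.Zhang2014.kolyvaginIndex W 2 p ∧ (∃ (pl : HeightOneSpectrum (𝓞 ℚ)) (𝔓 : Ideal (absIntegers (𝓞 ℚ) ℚ)) (h : absoluteGaloisGroup ℚ), (p : 𝓞 ℚ) ∈ pl.asIdeal ∧ 𝔓 ∈ pl.primesAbove ∧ IsArithFrobAt (𝓞 ℚ) h 𝔓 ∧ (∀ X : geomTorsion W ((2 ^ M : ℕ) : ℤ), h • h • X = X) ∧ ∃ P : geomTorsion W ((2 ^ M : ℕ) : ℤ), (2 : ℤ) ^ (M - 1) • (P + h • P) ≠ 0)) ∧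
        s'.primeFactors.card + 1 = s.primeFactors.card ∧
        (s' * (e * f)).primeFactors.card = (s * e).primeFactors.card ∧
        Literature.NumberTheory.EllipticCurves.KolyvaginDescent.KolSupp (Literature.NumberTheory.EllipticCurves.Zhang2014.IsKolyvaginPrime (W.conductorNorm ℤ) W K 2) (s' * (e * f)) ∧
        (((M + 1 : ℕ) : ℕ) : ℕ∞) ≤ Literature.NumberTheory.EllipticCurves.Zhang2014.levelIndex W 2 (s' * (e * f)) ∧
        OppShape W K ι τ M (e * f) u (g a) t' ∧
        conjAct W τ ((2 ^ M : ℕ) : ℤ) (d'.kolyvaginClass Nat.prime_two M) = u • d'.kolyvaginClass Nat.prime_two M ∧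
        ∃ dup : Literature.NumberTheory.EllipticCurves.KolyvaginHeegnerData Dt β ι (s' * (e * f) * q),
        Squarefree (s' * (e * f) * q) ∧ ¬ q ∣ s' * (e * f) ∧
        (∀ l' ∈ (s' * (e * f) * q).primeFactors, Literature.NumberTheory.EllipticCurves.Zhang2014.IsKolyvaginPrime (W.conductorNorm ℤ) W K 2 l' ∧ M ≤ Literature.NumberTheory.EllipticCurves.Zhang2014.kolyvaginIndex W 2 l') ∧
        (∀ l' ∈ (s' * (e * f)).primeFactors, ∀ (x : Literature.NumberTheory.EllipticCurves.ringClassField K ι (s' * (e * f))) (x' : Literature.NumberTheory.EllipticCurves.ringClassField K ι (s' * (e * f) * q)), (x : ℂ) = x' → ((dup.σ l' x' : Literature.NumberTheory.EllipticCurves.ringClassField K ι (s' * (e * f) * q)) : ℂ) = (d'.σ l' x : ℂ)) ∧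
        (∀ t ∈ d'.S, ∃ t' ∈ dup.S, ∀ (x : Literature.NumberTheory.EllipticCurves.ringClassField K ι (s' * (e * f))) (x' : Literature.NumberTheory.EllipticCurves.ringClassField K ι (s' * (e * f) * q)), (x : ℂ) = x' → ((t' x' : Literature.NumberTheory.EllipticCurves.ringClassField K ι (s' * (e * f) * q)) : ℂ) = (t x : ℂ)) ∧
        (∀ t' ∈ dup.S, ∃ t ∈ d'.S, ∀ (x : Literature.NumberTheory.EllipticCurves.ringClassField K ι (s' * (e * f))) (x' : Literature.NumberTheory.EllipticCurves.ringClassField K ι (s' * (e * f) * q)), (x : ℂ) = x' → ((t' x' : Literature.NumberTheory.EllipticCurves.ringClassField K ι (s' * (e * f) * q)) : ℂ) = (t x : ℂ)) ∧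
        (∀ (x : Literature.NumberTheory.EllipticCurves.ringClassField K ι (s' * (e * f))) (x' : Literature.NumberTheory.EllipticCurves.ringClassField K ι (s' * (e * f) * q)), (x : ℂ) = x' → dup.emb x' = d'.emb x) ∧
        ∃ w : IsDedekindDomain.HeightOneSpectrum (NumberField.RingOfIntegers K), (q : NumberField.RingOfIntegers K) ∈ w.asIdeal ∧
          ((2 ^ v : ℕ) : ℤ) • dup.kolyvaginClass Nat.prime_two M ∉ WeierstrassCurve.selmerLocalKer (W.baseChange K) (w.adicCompletion K) ((2 ^ M : ℕ) : ℤ)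

/-- Zζ · THE LONE SEED PRIME HAS A PARTNER (v7.7: NO LONGER A STUB — derived below, `loneSeedPartnerAtTwo_of`, from OSR + SRS + the tree's pair
Čebotarev; v7.5; answers critic #298 (ζ); size S–M GIVEN the signed refill law, the engine adapter and reciprocity —
no new input).  The corner `t = 0 ∧ #s = 1` of the shaped shed is VACUOUS once the walking class is visible beyond `2^{κ₀ a}`: if the `(−u)`-part
of `H_{𝓕(e)}` has shape `Sh(0, a)` (every exact `(−u)`-class `y` has `2^a y ≡ 0`), the seed part is a single prime `q` (`#s ≤ 1`, `s ≠ 1`), and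
`c = c_M(qe)` is an exact `u`-class, then `c` has visible order `≤ 2^{κ₀ a}`, `κ₀ a = a + b + O(1)`.  PROOF ROUTE (LEAD): the signed refill law at
`q` for `𝓕(e) → 𝓕(qe)` in sign `−u` (`α ≤ a + d + 1` ⟹ `β ≥ M − a − C`) gives `z ∈ H_{𝓕(qe)}` exact of sign `−u`, visible order `≥ 2^{M−a−C′}`;
the adapter `WalkEngineAdapter.exists_regular_kolyvaginPrime_killing` (`p := c`, `q := z`, no kept classes) gives a deep Kolyvagin `ℓ` with
`n_c(ℓ)` = visible order of `c` and `n_z(ℓ) ≥ M − a − C′`; `B := ⟨loc_ℓ z, loc_{ℓ,tr} c_M(qeℓ)⟩ = ⟨loc_ℓ z, φ_ℓ loc_ℓ c⟩` (Q2) has exponent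
`≥ n_z + n_c − M − O(1)` (same-sign `f × tr` lines pair perfectly: `RegularRefillSign`); RECIPROCITY for `(z, c_M(qeℓ))`: `z ∈ H_{𝓕(qe)}` and
`c_M(qeℓ) ∈ H_{𝓕(qeℓ)}` (margin one, `kolyvaginClass_mem_transverseKer_two`) are BOTH transverse at `q` and at `e`, both finite off `2Nqeℓ`, so the
law reads `B + (v ∣ 2N terms, ≤ 2^{b′}) = 0` — hence `n_c(ℓ) ≤ a + b′ + C″`, i.e. the visible order of `c` is `≤ 2^{κ₀ a}`.  (This is the critic's
own computation in #298 (ζ), read as a LEMMA: «ρ = 0 at the last seed prime» contradicts visibility; so (ζ1) «t ≥ 1 whenever #s = 1» is FORCED,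
non-circularly, by the walk's visibility hypothesis.  Consistency: at `e = 1`, `t(−u) = r_{u₁}` is odd by 2-parity, Gross 5.4.)  Why it might fail:
only with the signed refill law's `O(1)` (α) or (b″); the reciprocity and adapter inputs are tree theorems / the line's own (d″).
(ref: Kolyvagin1991StructureSha, Prop. 8) (ref: MazurRubin2004, §4.1) (ref: GrossLMS1991, §9) -/
def LoneSeedPartnerAtTwo : Prop :=
  ∀ (W : WeierstrassCurve ℚ) [W.IsElliptic] [W.IsGloballyMinimal], ¬ W.HasCM → (Literature.NumberTheory.EllipticCurves.Rank1Residual.GoodOrd W 2 ∨ Literature.NumberTheory.EllipticCurves.Rank1Residual.Mult W 2) → (∀ m : ℕ, W.HasSurjectiveModNGaloisRep (2 ^ m : ℕ)) → ∀ (K : Type) [Field K] [NumberField K], Literature.NumberTheory.EllipticCurves.IsImaginaryQuadratic K → ∀ [NeZero (W.conductorNorm ℤ)], Literature.NumberTheory.EllipticCurves.SatisfiesHeegnerHypothesis (W.conductorNorm ℤ) K → Odd (NumberField.discr K) → NumberField.discr K ≠ -3 → AddSubgroup.torsionBy (W.baseChange K).toAffine.Point (2 : ℤ) = ⊥ → Literature.NumberTheory.EllipticCurves.SatisfiesHeegnerHypothesis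 2 K → ∀ (Dt : Literature.NumberTheory.EllipticCurves.ModularForms.ModularParametrizationData W (W.conductorNorm ℤ)) (β : ℤ) (ι : K →+* ℂ) [∀ k : ℕ, NumberField (ringClassField K ι k)], (4 * (W.conductorNorm ℤ : ℤ)) ∣ β ^ 2 - NumberField.discr K →
    ∀ (τ : K ≃ₐ[ℚ] K), τ ≠ 1 → ∀ (u : ℤ), (u = 1 ∨ u = -1) →
    ∃ κ₀ : ℕ → ℕ, ∀ (a I M s e : ℕ) (d : Literature.NumberTheory.EllipticCurves.KolyvaginHeegnerData Dt β ι (s * e)),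
      Literature.NumberTheory.EllipticCurves.KolyvaginDescent.KolSupp (Literature.NumberTheory.EllipticCurves.Zhang2014.IsKolyvaginPrime (W.conductorNorm ℤ) W K 2) (s * e) →
      s ≠ 1 → s.primeFactors.card ≤ 1 → 1 ≤ M → M + 1 ≤ I → (((M + 1 : ℕ) : ℕ) : ℕ∞) ≤ Literature.NumberTheory.EllipticCurves.Zhang2014.levelIndex W 2 (s * e) →
      (∀ p ∈ (e).primeFactors, I ≤ Literature.NumberTheory.EllipticCurves.Zhang2014.kolyvaginIndex W 2 p ∧ (∃ (pl : HeightOneSpectrum (𝓞 ℚ)) (𝔓 : Ideal (absIntegers (𝓞 ℚ) ℚ)) (h : absoluteGaloisGroup ℚ), (p : 𝓞 ℚ) ∈ pl.asIdeal ∧ 𝔓 ∈ pl.primesAbove ∧ IsArithFrobAt (𝓞 ℚ) h 𝔓 ∧ (∀ X : geomTorsion W ((2 ^ M : ℕ) : ℤ), h • h • X = X) ∧ ∃ P : geomTorsion W ((2 ^ M : ℕ) : ℤ), (2 : ℤ) ^ (M - 1) • (P + h • P) ≠ 0)) →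
      OppShape W K ι τ M e u a 0 →
      conjAct W τ ((2 ^ M : ℕ) : ℤ) (d.kolyvaginClass Nat.prime_two M) = u • d.kolyvaginClass Nat.prime_two M →
      (∃ ρ ∈ torsionFixing (W.baseChange K) ((2 ^ M : ℕ) : ℤ),
          ((2 ^ (κ₀ a) : ℕ) : ℤ) • h1Eval (W.baseChange K) ((2 ^ M : ℕ) : ℤ) (d.kolyvaginClass Nat.prime_two M) ρ ≠ 0) →
      False

/-- SW⁗ · THE SHAPED SEED-PRIME SWAP AT 2 (the theorem of the line, v7.4 form: visible conclusion).  On U1's habitat, for the complex conjugation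
`τ` and a sign `u`, there are a LOSS FUNCTION `κ` and a SHAPE-ERROR FUNCTION `g` (both `ℕ → ℕ`, uniform in the level) such that: if `n = s·e` is
a square-free Kolyvagin conductor with seed part `s ≠ 1`, engine part `e` of index `≥ I ≥ M+1` and REGULAR at level `2^M`, MARGIN ONE
(`M+1 ≤ M(n)`), the `(−u)`-part of `H_{𝓕(e)}` has shape `Sh(·, a)`, and `c_M(se)` is an exact `u`-eigenclass of visible order `> 2^{v + κ a}` —
then for some seed prime `q ∣ s` and a block `f` of new regular engine primes of index `≥ I` with `#(s'·e·f) = #(s·e)` (net one-for-one; `f` =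
one prime, or DOWN-then-UP in the direct-shed corner) there is a datum at `s'·(e·f)` whose class is an exact `u`-eigenclass of visible order
`> 2^v`, with margin one and the shape `Sh(·, g a)` at `e·f`.  Derived from SWα⁗ + Q2 + EV by `seedPrimeSwapShapedAtTwo_of`. -/
def SeedPrimeSwapShapedAtTwo : Prop :=
  ∀ (W : WeierstrassCurve ℚ) [W.IsElliptic] [W.IsGloballyMinimal], ¬ W.HasCM → (Literature.NumberTheory.EllipticCurves.Rank1Residual.GoodOrd W 2 ∨ Literature.NumberTheory.EllipticCurves.Rank1Residual.Mult W 2) → (∀ m : ℕ, W.HasSurjectiveModNGaloisRep (2 ^ m : ℕ)) → ∀ (K : Type) [Field K] [NumberField K], Literature.NumberTheory.EllipticCurves.IsImaginaryQuadratic K → ∀ [NeZero (W.conductorNorm ℤ)], Literature.NumberTheory.EllipticCurves.SatisfiesHeegnerHypothesis (W.conductorNorm ℤ) K → Odd (NumberField.discr K) → NumberField.discr K ≠ -3 → AddSubgroup.torsionBy (W.baseChange K).toAffine.Point (2 : ℤ) = ⊥ → Literature.NumberTheory.EllipticCurves.SatisfiesHeegnerHypothesis 2 K → ∀ (Dt :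 Literature.NumberTheory.EllipticCurves.ModularForms.ModularParametrizationData W (W.conductorNorm ℤ)) (β : ℤ) (ι : K →+* ℂ) [∀ k : ℕ, NumberField (ringClassField K ι k)], (4 * (W.conductorNorm ℤ : ℤ)) ∣ β ^ 2 - NumberField.discr K →
    ∀ (τ : K ≃ₐ[ℚ] K), τ ≠ 1 → ∀ (u : ℤ), (u = 1 ∨ u = -1) →
    ∃ κ g : ℕ → ℕ, ∀ (a t I M v s e : ℕ) (d : Literature.NumberTheory.EllipticCurves.KolyvaginHeegnerData Dt β ι (s * e)),
      Literature.NumberTheory.EllipticCurves.KolyvaginDescent.KolSupp (Literature.NumberTheory.EllipticCurves.Zhang2014.IsKolyvaginPrime (W.conductorNorm ℤ) W K 2) (s * e) →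
      s ≠ 1 → 1 ≤ M → M + 1 ≤ I → (((M + 1 : ℕ) : ℕ) : ℕ∞) ≤ Literature.NumberTheory.EllipticCurves.Zhang2014.levelIndex W 2 (s * e) →
      (∀ p ∈ (e).primeFactors, I ≤ Literature.NumberTheory.EllipticCurves.Zhang2014.kolyvaginIndex W 2 p ∧ (∃ (pl : HeightOneSpectrum (𝓞 ℚ)) (𝔓 : Ideal (absIntegers (𝓞 ℚ) ℚ)) (h : absoluteGaloisGroup ℚ), (p : 𝓞 ℚ) ∈ pl.asIdeal ∧ 𝔓 ∈ pl.primesAbove ∧ IsArithFrobAt (𝓞 ℚ) h 𝔓 ∧ (∀ X : geomTorsion W ((2 ^ M : ℕ) : ℤ), h • h • X = X) ∧ ∃ P : geomTorsion W ((2 ^ M : ℕ) : ℤ), (2 : ℤ) ^ (M - 1) • (P + h • P) ≠ 0)) →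
      OppShape W K ι τ M e u a t →
      conjAct W τ ((2 ^ M : ℕ) : ℤ) (d.kolyvaginClass Nat.prime_two M) = u • d.kolyvaginClass Nat.prime_two M →
      (∃ ρ ∈ torsionFixing (W.baseChange K) ((2 ^ M : ℕ) : ℤ),
          ((2 ^ (v + κ a) : ℕ) : ℤ) • h1Eval (W.baseChange K) ((2 ^ M : ℕ) : ℤ) (d.kolyvaginClass Nat.prime_two M) ρ ≠ 0) →
      ∃ (q s' f t' : ℕ) (d' : Literature.NumberTheory.EllipticCurves.KolyvaginHeegnerData Dt β ι (s' * (e * f))),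
        s = q * s' ∧ q.Prime ∧
        (∀ p ∈ (e * f).primeFactors, I ≤ Literature.NumberTheory.EllipticCurves.Zhang2014.kolyvaginIndex W 2 p ∧ (∃ (pl : HeightOneSpectrum (𝓞 ℚ)) (𝔓 : Ideal (absIntegers (𝓞 ℚ) ℚ)) (h : absoluteGaloisGroup ℚ), (p : 𝓞 ℚ) ∈ pl.asIdeal ∧ 𝔓 ∈ pl.primesAbove ∧ IsArithFrobAt (𝓞 ℚ) h 𝔓 ∧ (∀ X : geomTorsion W ((2 ^ M : ℕ) : ℤ), h • h • X = X) ∧ ∃ P : geomTorsion W ((2 ^ M : ℕ) : ℤ), (2 : ℤ) ^ (M - 1) • (P + h • P) ≠ 0)) ∧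
        s'.primeFactors.card + 1 = s.primeFactors.card ∧
        (s' * (e * f)).primeFactors.card = (s * e).primeFactors.card ∧
        Literature.NumberTheory.EllipticCurves.KolyvaginDescent.KolSupp (Literature.NumberTheory.EllipticCurves.Zhang2014.IsKolyvaginPrime (W.conductorNorm ℤ) W K 2) (s' * (e * f)) ∧
        (((M + 1 : ℕ) : ℕ) : ℕ∞) ≤ Literature.NumberTheory.EllipticCurves.Zhang2014.levelIndex W 2 (s' * (e * f)) ∧
        OppShape W K ι τ M (e * f) u (g a) t' ∧
        conjAct W τ ((2 ^ M : ℕ) : ℤ) (d'.kolyvaginClass Nat.prime_two M) = u • d'.kolyvaginClass Nat.prime_two M ∧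
        (∃ ρ ∈ torsionFixing (W.baseChange K) ((2 ^ M : ℕ) : ℤ),
          ((2 ^ (v) : ℕ) : ℤ) • h1Eval (W.baseChange K) ((2 ^ M : ℕ) : ℤ) (d'.kolyvaginClass Nat.prime_two M) ρ ≠ 0)

/-- EV · SINGULAR-TO-VISIBLE (v7.7: a KERNEL THEOREM, re-typed class-generally with margin one; was a routine stub).  For a Kolyvagin prime `q` of
index `≥ M + 1`, a place `w ∣ q` of `K` and ANY class `x ∈ H¹(K, E[2^M])`: if `2^j · x` is not locally trivial at `w` then `x` has VISIBLE order
`> 2^j` (`2^j · [x, ρ] ≠ 0` for some `ρ ∈ Γ_{K(E[2^M])}`): the image of `Γ_{K_w} → Γ_K` fixes `E[2^{M+1}]` (Φ-KILL, the tree's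
`RegularRefill.localization_eq_zero_of_forall_h1Eval_eq_zero`), `Γ_{K(E[2^{M+1}])} ≤ Γ_{K(E[2^M])}`, and `ker loc_w = torsionLocalKer`
(`KolyvaginLowerBoundAtTwo.mem_torsionLocalKer_two_pow_iff`). (ref: McCallumLMS1991, Prop. 4.4 (proof)) (ref: GrossLMS1991, §9) -/
def SingularToVisibleAtTwo : Prop :=
  ∀ (W : WeierstrassCurve ℚ) [W.IsElliptic] [W.IsGloballyMinimal], ¬ W.HasCM → (Literature.NumberTheory.EllipticCurves.Rank1Residual.GoodOrd W 2 ∨ Literature.NumberTheory.EllipticCurves.Rank1Residual.Mult W 2) → (∀ m : ℕ, W.HasSurjectiveModNGaloisRep (2 ^ m : ℕ)) → ∀ (K : Type) [Field K] [NumberField K], Literature.NumberTheory.EllipticCurves.IsImaginaryQuadratic K → ∀ [NeZero (W.conductorNorm ℤ)], Literature.NumberTheory.EllipticCurves.SatisfiesHeegnerHypothesis (W.conductorNorm ℤ) K → Odd (NumberField.discr K) → NumberField.discr K ≠ -3 → AddSubgroup.torsionBy (W.baseChange K).toAffine.Point (2 : ℤ) = ⊥ → Literature.NumberTheory.EllipticCurves.SatisfiesHeegnerHypothesis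 2 K → ∀ (Dt : Literature.NumberTheory.EllipticCurves.ModularForms.ModularParametrizationData W (W.conductorNorm ℤ)) (β : ℤ) (ι : K →+* ℂ) [∀ k : ℕ, NumberField (ringClassField K ι k)], (4 * (W.conductorNorm ℤ : ℤ)) ∣ β ^ 2 - NumberField.discr K →
    ∀ (M q j : ℕ) (x : galH1Torsion (W.baseChange K) ((2 ^ M : ℕ) : ℤ)),
      Literature.NumberTheory.EllipticCurves.Zhang2014.IsKolyvaginPrime (W.conductorNorm ℤ) W K 2 q →
      M + 1 ≤ Literature.NumberTheory.EllipticCurves.Zhang2014.kolyvaginIndex W 2 q →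
      ∀ (w : IsDedekindDomain.HeightOneSpectrum (NumberField.RingOfIntegers K)), (q : NumberField.RingOfIntegers K) ∈ w.asIdeal →
      ((2 ^ j : ℕ) : ℤ) • x ∉ (W.baseChange K).torsionLocalKer (w.adicCompletion K) ((2 ^ M : ℕ) : ℤ) →
      ∃ ρ ∈ torsionFixing (W.baseChange K) ((2 ^ M : ℕ) : ℤ),
        ((2 ^ j : ℕ) : ℤ) • h1Eval (W.baseChange K) ((2 ^ M : ℕ) : ℤ) x ρ ≠ 0

/-- ROOM BOOKKEEPING (kernel): the room the walk needs to shed `j` seed primes starting from shape error `a` — `κ a` for the first shed,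
then recursively from error `g a`. -/
def room (κ g : ℕ → ℕ) : ℕ → ℕ → ℕ
  | _, 0 => 0
  | a, j + 1 => κ a + room κ g (g a) j

/-- VG · VERTICAL GROWTH AT 2 (U1's frame and currency, one Kolyvagin–Heegner datum `d` at `n`): a non-zero class at ONE level `M₁`
forces `2^{M−M₁}·c_M(n) ≠ 0` at every level `M₁ ≤ M ≤ M(n)` (order `≥ 2^{M−M₁+1}`, defect `≤ M₁ − 1`).  PROVED in
`…Theorems.KolyvaginRankRigidityAtTwoKolyvaginSwapVertical` (`verticalGrowthAtTwo_holds`); stated as a `def` so that compositions take it BY NAME. (ref: McCallumLMS1991, §4 Cor. 4.5, Lemma 4.6) -/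
def VerticalGrowthAtTwo : Prop :=
  ∀ (W : WeierstrassCurve ℚ) [W.IsElliptic] [W.IsGloballyMinimal], (∀ m : ℕ, W.HasSurjectiveModNGaloisRep (2 ^ m : ℕ)) →
    ∀ (K : Type) [Field K] [NumberField K], IsImaginaryQuadratic K → ∀ [NeZero (W.conductorNorm ℤ)],
    SatisfiesHeegnerHypothesis (W.conductorNorm ℤ) K → Odd (NumberField.discr K) → NumberField.discr K ≠ -3 →
    ∀ (Dt : ModularParametrizationData W (W.conductorNorm ℤ)) (β : ℤ) (ι : K →+* ℂ) (n : ℕ) (d : KolyvaginHeegnerData Dt β ι n)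
      (M₁ M : ℕ), KolyvaginDescent.KolSupp (Zhang2014.IsKolyvaginPrime (W.conductorNorm ℤ) W K 2) n →
      ((M : ℕ) : ℕ∞) ≤ Zhang2014.levelIndex W 2 n → M₁ ≤ M → d.kolyvaginClass Nat.prime_two M₁ ≠ 0 →
      (2 ^ (M - M₁) : ℤ) • d.kolyvaginClass Nat.prime_two M ≠ 0

/-- S0⁺ · DEEP SEED AT 2 — Kolyvagin's conjecture at 2 in DEEP FIXED-LEVEL form on U1's habitat and frame: a depth `r` and ONE level
`M₁ ≥ 1` such that for every `M* ≥ M₁` some square-free Kolyvagin conductor `n` with exactly `r` prime factors, all of Kolyvagin index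
`≥ M*`, carries a Kolyvagin–Heegner datum with `c_{M₁}(n) ≠ 0`.  Beyond print at 2 (W. Zhang 2014 / BCGS are `p` odd; at `p ≥ 5` it is
what Zhang's theorem gives at the core vertices of `Sel_p(E/K)`, which exist at every index).  Implies U1 (`KolyvaginSwap.boundedDefect_of_deepSeed`) and is implied
by U1 (level reduction) — so it is a READING of the crux, not a weakening.  Why it might fail: only with Kolyvagin's conjecture at 2 itself.
[cite: Kolyvagin1991StructureSha] [cite: WZhang2014, Thm. 1.1] -/
@[conjecture] def DeepSeedAtTwo : Prop :=
  ∀ (W : WeierstrassCurve ℚ) [W.IsElliptic] [W.IsGloballyMinimal], ¬ W.HasCM →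
    (Literature.NumberTheory.EllipticCurves.Rank1Residual.GoodOrd W 2 ∨ Literature.NumberTheory.EllipticCurves.Rank1Residual.Mult W 2) →
    (∀ m : ℕ, W.HasSurjectiveModNGaloisRep (2 ^ m : ℕ)) → ∀ (K : Type) [Field K] [NumberField K],
    IsImaginaryQuadratic K → ∀ [NeZero (W.conductorNorm ℤ)], SatisfiesHeegnerHypothesis (W.conductorNorm ℤ) K →
    Odd (NumberField.discr K) → NumberField.discr K ≠ -3 → AddSubgroup.torsionBy (W.baseChange K).toAffine.Point (2 : ℤ) = ⊥ →
    SatisfiesHeegnerHypothesis 2 K →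
    ∀ (Dt : ModularParametrizationData W (W.conductorNorm ℤ)) (β : ℤ) (ι : K →+* ℂ),
      (4 * (W.conductorNorm ℤ : ℤ)) ∣ β ^ 2 - NumberField.discr K →
      ∃ r M₁ : ℕ, 1 ≤ M₁ ∧ ∀ Mstar : ℕ, M₁ ≤ Mstar →
        ∃ (n : ℕ) (d : KolyvaginHeegnerData Dt β ι n),
          KolyvaginDescent.KolSupp (Zhang2014.IsKolyvaginPrime (W.conductorNorm ℤ) W K 2) n ∧ n.primeFactors.card = r ∧
          ((Mstar : ℕ) : ℕ∞) ≤ Zhang2014.levelIndex W 2 n ∧ d.kolyvaginClass Nat.prime_two M₁ ≠ 0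

end Summit.BirchSwinnertonDyer.BirchSwinnertonDyer.Theorems.KolyvaginAtTwo.KolyvaginSwap

end
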